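import Summits.Ventures.PercRepro.Night2LocalAllLayerZero

/-!
# PercRepro — the regime `|E ∖ G| = 1` with a coloop is layer 0 (night-2, gen 9)

At a rank-`(q+1)` flat `G` with `|E ∖ G| = 1` the complement of a member `B` inside `G` spans `M|G`
(`eRk_sdiff_of_card_compl_one`): `E ∖ B = (G ∖ B) ∪ {w}` has rank `q + 2` and `w` adds at most one.  A
spanning set contains every coloop of `M|G`, so a coloop `y` of `M|G` lies outside every member, and the
closure of a member is the hyperplane `G ∖ {y}` (`clF_eq_erase_of_coloop`): every member is a layer-0 member
and `localShadowHall_of_all_lay0` applies.  Hence, at `|E ∖ G| = 1`, the local form (LI_G) holds as soon as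
`M|G` has a coloop (`localShadowHall_of_card_compl_one_of_coloop`); the open part of the regime is the
coloop-free restriction (NIGHT-2-local.md §18: the injection statement INJ-d1).
-/

namespace PercRepro.Shadow

open Finset PerFlat ThmH

variable {α : Type*} [DecidableEq α] {M : Matroid α} [M.Finite]

open scoped Classical in
/-- At `|E ∖ G| = 1` the complement `G ∖ B` of a member spans `G`. -/
theorem eRk_sdiff_of_card_compl_one {q : ℕ} {G : Finset α} (hG : G ∈ flatsQ M (q + 1))
    (hd : (gr M \ G).card = 1) {B : Finset α} (hB : B ∈ membersIn M (Uq M (q + 2) q) G) :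
    M.eRk ((G \ B : Finset α) : Set α) = ((q + 1 : ℕ) : ℕ∞) := by
  have hGg : G ⊆ gr M := (mem_flatsQ.1 hG).1
  have hGr : M.eRk (G : Set α) = ((q + 1 : ℕ) : ℕ∞) := (mem_flatsQ.1 hG).2.2
  have hBU : B ∈ Uq M (q + 2) q := (mem_membersIn.1 hB).1
  have hBc : M.eRk ((gr M \ B : Finset α) : Set α) = ((q + 2 : ℕ) : ℕ∞) := (mem_Uq.1 hBU).2.2
  apply le_antisymm
  · rw [← hGr]
    exact M.eRk_mono (by exact_mod_cast Finset.sdiff_subset)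
  · -- `E ∖ B ⊆ (G ∖ B) ∪ (E ∖ G)` and `E ∖ G` is a single element
    have hsub : gr M \ B ⊆ (G \ B) ∪ (gr M \ G) := by
      intro e he
      rw [Finset.mem_sdiff] at he
      rw [Finset.mem_union, Finset.mem_sdiff, Finset.mem_sdiff]
      by_cases heG : e ∈ G
      · exact Or.inl ⟨heG, he.2⟩
      · exact Or.inr ⟨he.1, heG⟩
    have h1 : M.eRk ((gr M \ G : Finset α) : Set α) ≤ 1 := by
      have := M.eRk_le_encard ((gr M \ G : Finset α) : Set α)
      rw [Set.encard_coe_eq_coe_finsetCard, hd] at this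
      exact_mod_cast this
    have h2 : ((q + 2 : ℕ) : ℕ∞) ≤ M.eRk ((G \ B : Finset α) : Set α) + 1 := by
      calc ((q + 2 : ℕ) : ℕ∞) = M.eRk ((gr M \ B : Finset α) : Set α) := hBc.symm
        _ ≤ M.eRk (((G \ B) ∪ (gr M \ G) : Finset α) : Set α) := M.eRk_mono (by exact_mod_cast hsub)
        _ ≤ M.eRk ((G \ B : Finset α) : Set α) + M.eRk ((gr M \ G : Finset α) : Set α) := by
            push_cast; exact M.eRk_union_le_eRk_add_eRk _ _
        _ ≤ M.eRk ((G \ B : Finset α) : Set α) + 1 := by gcongr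
    have h3 : M.eRk ((G \ B : Finset α) : Set α) ≠ ⊤ := eRk_ne_top _
    obtain ⟨a, ha⟩ := WithTop.ne_top_iff_exists.1 h3
    rw [← ha] at h2 ⊢
    have h4 : ((q + 2 : ℕ) : ℕ∞) ≤ ((a + 1 : ℕ) : ℕ∞) := by push_cast; exact h2
    have h5 : q + 2 ≤ a + 1 := Nat.cast_le.1 h4
    exact Nat.cast_le.2 (by omega)

open scoped Classical in
/-- At `|E ∖ G| = 1`, a coloop `y` of `M|G` lies outside every member and the member's closure is `G ∖ {y}`. -/
theorem clF_eq_erase_of_coloop {q : ℕ} {G : Finset α} (hG : G ∈ flatsQ M (q + 1))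
    (hd : (gr M \ G).card = 1) {y : α} (hyG : y ∈ G) (hy : y ∉ clF M (G.erase y)) {B : Finset α}
    (hB : B ∈ membersIn M (Uq M (q + 2) q) G) : clF M B = G.erase y := by
  have hGg : G ⊆ gr M := (mem_flatsQ.1 hG).1
  have hGr : M.eRk (G : Set α) = ((q + 1 : ℕ) : ℕ∞) := (mem_flatsQ.1 hG).2.2
  have hBU : B ∈ Uq M (q + 2) q := (mem_membersIn.1 hB).1
  have hBG : clF M B ⊆ G := (mem_membersIn.1 hB).2
  have hFr : M.eRk ((clF M B : Finset α) : Set α) = (q : ℕ∞) := by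
    rw [coe_clF, M.eRk_closure_eq, (mem_Uq.1 hBU).2.1]
  -- `G ∖ y` has rank `q`
  have hGe : M.eRk ((G.erase y : Finset α) : Set α) = (q : ℕ∞) := by
    have h1 := eRk_insert_of_notMem_clF_erase hGg hyG hy (X := G.erase y) le_rfl
    rw [Finset.insert_erase hyG, hGr] at h1
    have h2 : (q : ℕ∞) + 1 = M.eRk ((G.erase y : Finset α) : Set α) + 1 := by
      rw [← h1]; push_cast; rfl
    exact (WithTop.add_right_cancel ENat.one_ne_top h2).symm
  -- `y ∉ B`: otherwise `G ∖ B ⊆ G ∖ y` would have rank `≤ q`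
  have hyB : y ∉ B := by
    intro hyB
    have hsub : G \ B ⊆ G.erase y := by
      intro e he
      rw [Finset.mem_sdiff] at he
      rw [Finset.mem_erase]
      exact ⟨fun h => he.2 (h ▸ hyB), he.1⟩
    have h := M.eRk_mono (by exact_mod_cast hsub : ((G \ B : Finset α) : Set α) ⊆ ((G.erase y : Finset α) : Set α))
    rw [eRk_sdiff_of_card_compl_one hG hd hB, hGe] at h
    have : q + 1 ≤ q := by exact_mod_cast h
    omega
  -- so `B ⊆ G ∖ y` and `cl B ⊆ cl (G ∖ y) = G ∖ y`
  have hBe : B ⊆ G.erase y := by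
    intro e he
    rw [Finset.mem_erase]
    exact ⟨fun h => hyB (h ▸ he), hBG (subset_clF hBU he)⟩
  have hclGe : clF M (G.erase y) = G.erase y := by
    apply le_antisymm
    · intro e he
      rw [Finset.mem_erase]
      refine ⟨fun h => hy (h ▸ he), ?_⟩
      have hGflat : M.IsFlat (G : Set α) := (mem_flatsQ.1 hG).2.1
      have : e ∈ M.closure ((G.erase y : Finset α) : Set α) := by rw [← coe_clF]; exact_mod_cast he
      have h2 := M.closure_subset_closure (by exact_mod_cast Finset.erase_subset y G :
        ((G.erase y : Finset α) : Set α) ⊆ (G : Set α)) this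
      rw [hGflat.closure] at h2
      exact_mod_cast h2
    · rw [← Finset.coe_subset, coe_clF]
      exact M.subset_closure _ (by rw [← coe_gr]; exact_mod_cast (Finset.erase_subset _ _).trans hGg)
  have hsub : clF M B ⊆ G.erase y := by
    rw [← hclGe]; exact clF_mono hBe
  -- equal ranks give equal closures
  have hGeF : G.erase y ⊆ clF M (clF M B) := by
    have h := (M.isRkFinite_of_finite (clF M B).finite_toSet).closure_eq_closure_of_subset_of_eRk_ge_eRk
      (by exact_mod_cast hsub : ((clF M B : Finset α) : Set α) ⊆ ((G.erase y : Finset α) : Set α))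
      (by rw [hGe, hFr])
    rw [← Finset.coe_subset, coe_clF, h]
    exact M.subset_closure _ (by rw [← coe_gr]; exact_mod_cast (Finset.erase_subset _ _).trans hGg)
  have hidem : clF M (clF M B) = clF M B := by
    rw [← Finset.coe_inj, coe_clF, coe_clF, Matroid.closure_closure]
  rw [hidem] at hGeF
  exact le_antisymm hsub hGeF

open scoped Classical in
/-- **`|E ∖ G| = 1` with a coloop of `M|G` is layer 0**: the local form holds at every rank-`(q+1)` flat `G`
with `|E ∖ G| = 1` whose restriction `M|G` has a coloop (`1 ≤ q`). -/
theorem localShadowHall_of_card_compl_one_of_coloop {q : ℕ} (hq : 1 ≤ q) {G : Finset α}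
    (hG : G ∈ flatsQ M (q + 1)) (hd : (gr M \ G).card = 1) (hk : 1 ≤ kColoops M G) :
    LocalShadowHall M q G := by
  apply localShadowHall_of_all_lay0 hG (by omega)
  intro B hB
  have hne : (G.filter (fun y => y ∉ clF M (G.erase y))).Nonempty := by
    rw [← Finset.card_pos]; exact hk
  obtain ⟨y, hy⟩ := hne
  rw [Finset.mem_filter] at hy
  rw [clF_eq_erase_of_coloop hG hd hy.1 hy.2 hB, Finset.sdiff_erase_self hy.1]
  exact Finset.card_singleton y

end PercRepro.Shadow
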